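import Literature.NumberTheory.Rogawski1990.Ch3Sec10to13Holds
import Literature.NumberTheory.GaloisRepresentations.LocalFieldFiniteExtension
import Literature.NumberTheory.LocalFields.LocalFieldInvolutionNormIndexTwo
import HarnessLib

/-!
# [Rogawski1990, §3.8 (3.8.1) p. 31, §3.11 p. 35] The `p`-ADIC BRIDGE for the carpet ★ `Ch3Sec10to13`: under `IsPadicField F` and
# `IsQuadraticConj F E σ` the field `E` is a non-archimedean local field, `σ` is an involution `≠ 1`, and `[F^× : N E^×] = 2`

Companion THEOREM FILE (cell hodgecm-mathlib, seat B-typ01 (g34); theorems only — no definition, no named fact, no `sorry`, no instance, no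
notation; count-neutral) of ★ `Literature/NumberTheory/Rogawski1990/Ch3Sec10to13.lean`.  The `p`-adic rows of that carpet (★ `prop3121cPadic`,
★ `prop3132aPadic`, ★ `prop3132bPadic`, ★ `prop3112d`, and ★ `prop3121aLocal` at a finite place) carry their ground-field hypothesis as ★
`IsPadicField F` — «`F` is `p`-adic»: `CharZero F ∧ ∃ (v : ValuativeRel F) (τ : TopologicalSpace F), IsNonarchimedeanLocalField F` — on the
BASE field `F`, while `E` is an abstract quadratic extension (★ `IsQuadraticConj F E σ`: `[E : F] = 2`, `σ ∈ Aut(E/F)`, `σ ≠ 1`).  The local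
inputs of their printed proofs live on `E`: «`H¹(F, E¹) = F^*/NE^*`» of order two (§3.11 p. 35, (3.8.1) p. 31).  Universes: `(F E : Type)`, as the
carpet after its ED. 5 «universe pin» (desk U943 (α′)) and as the Type-0 local toolkits.  This file moves the hypothesis across:
* `exists_isNonarchimedeanLocalField_of_isPadicField` — `E` carries a valuative relation and a topology making it a non-archimedean local field
  (★ `GaloisRepresentations.FiniteExtension.exists_isNonarchimedeanLocalField`: Serre, *Local Fields* II §2 Prop. 3), and `char E = 0`;
* `ringHom_ne_id_of_isQuadraticConj` — `(σ : E →+* E) ≠ id` (with ★ `IsQuadraticConj.apply_apply`: `σ ∘ σ = id`);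
* `exists_fixed_nonnorm_dichotomy_of_isPadicField` — **`[F^× : N E^×] = 2`** in the carpet's currency: a `σ`-fixed `t ≠ 0` of `E` which is not a
  norm `s·σ(s)`, such that every `σ`-fixed `q ≠ 0` is a norm or `t·q` is a norm (★ `LocalFields.LocalFieldInvolutionNorm.exists_fixed_nonnorm_dichotomy`,
  B-typ04 (g34)); and its `IsNormFromE` reading `isNormFromE_or_isNormFromE_mul`.
HONEST LABEL: HC_CM is proved only modulo the 7 printed citations (2 remaining named inputs: hLiu418 = stmt-HodgeConjecture-24832,
h413 = stmt-HodgeConjecture-24833) until rung 0 closes; this file is off that cone and adds no citation debt (0 facts, 0 sorry).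
-/

noncomputable section

namespace Literature.NumberTheory.Rogawski1990.Ch3Sec10to13

variable (F E : Type) [Field F] [Field E] [Algebra F E] (σ : E ≃ₐ[F] E)

/-- **`E` IS A `p`-ADIC FIELD** when `F` is (`IsPadicField F`) and `E/F` is quadratic (`IsQuadraticConj F E σ`): some valuative relation and
topology on `E` make it a non-archimedean local field (the prolongation of the valuation of `F`, Serre II §2 Prop. 3, ★
`FiniteExtension.exists_isNonarchimedeanLocalField`), and `char E = 0`. [cite: Serre1979, Ch. II §2 Prop. 3] [cite: Rogawski1990, §1.1 p. 3] -/
theorem exists_isNonarchimedeanLocalField_of_isPadicField (hF : IsPadicField F) (hE : IsQuadraticConj F E σ) :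
    CharZero E ∧ ∃ (_ : ValuativeRel E) (_ : TopologicalSpace E), IsNonarchimedeanLocalField E := by
  obtain ⟨hF0, v, τ, hloc⟩ := hF
  haveI := hF0
  letI := v
  letI := τ
  haveI := hloc
  haveI : FiniteDimensional F E := Module.finite_of_finrank_pos (by rw [hE.1]; exact two_pos)
  refine ⟨charZero_of_injective_algebraMap (algebraMap F E).injective, ?_⟩
  obtain ⟨v', τ', h', -⟩ := Literature.NumberTheory.GaloisRepresentations.FiniteExtension.exists_isNonarchimedeanLocalField F E
  exact ⟨v', τ', h'⟩

/-- `σ ≠ 1` as a ring endomorphism of `E`. [cite: Rogawski1990, §1.9 p. 8] -/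
theorem ringHom_ne_id_of_isQuadraticConj (hE : IsQuadraticConj F E σ) : (σ : E →+* E) ≠ RingHom.id E := by
  intro h
  apply hE.2
  ext x
  exact congrArg (fun f : E →+* E => f x) h

/-- **`[F^× : N E^×] = 2` IN THE CARPET'S CURRENCY** («`H¹(F, E¹) = F^*/NE^*`», of order two for `F` `p`-adic): for `F` `p`-adic and `E/F`
quadratic with conjugation `σ`, there is a `σ`-fixed `t ≠ 0` in `E` which is not of the form `s·σ(s)`, and every `σ`-fixed `q ≠ 0` is `s·σ(s)` or
satisfies `t·q = s·σ(s)` for some `s`. [cite: Rogawski1990, §3.11 p. 35; §3.8 (3.8.1) p. 31] [cite: Serre1979, Ch. V §2 Prop. 3 Cor., §3 Cor. 3 to Prop. 5] -/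
theorem exists_fixed_nonnorm_dichotomy_of_isPadicField (hF : IsPadicField F) (hE : IsQuadraticConj F E σ) :
    ∃ t : E, σ t = t ∧ t ≠ 0 ∧ (∀ s : E, s * σ s ≠ t) ∧
      ∀ q : E, σ q = q → q ≠ 0 → (∃ s : E, s * σ s = q) ∨ (∃ s : E, s * σ s = t * q) := by
  obtain ⟨hE0, v', τ', h'⟩ := exists_isNonarchimedeanLocalField_of_isPadicField F E σ hF hE
  haveI := hE0
  letI := v'
  letI := τ'
  haveI := h'
  exact Literature.NumberTheory.LocalFields.LocalFieldInvolutionNorm.exists_fixed_nonnorm_dichotomy (σ : E →+* E)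
    (IsQuadraticConj.apply_apply F E σ hE) (ringHom_ne_id_of_isQuadraticConj F E σ hE)

/-- The same in the ★ `IsNormFromE` vocabulary of the carpet: a `σ`-fixed non-norm `t ≠ 0` with `IsNormFromE q ∨ IsNormFromE (t·q)` for every
`σ`-fixed `q ≠ 0`. [cite: Rogawski1990, §3.12 Prop. 3.12.1 (b) p. 37; §3.11 p. 35] -/
theorem isNormFromE_or_isNormFromE_mul (hF : IsPadicField F) (hE : IsQuadraticConj F E σ) :
    ∃ t : E, σ t = t ∧ t ≠ 0 ∧ ¬ IsNormFromE F E σ t ∧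
      ∀ q : E, σ q = q → q ≠ 0 → IsNormFromE F E σ q ∨ IsNormFromE F E σ (t * q) := by
  obtain ⟨t, hσt, ht0, htn, hdich⟩ := exists_fixed_nonnorm_dichotomy_of_isPadicField F E σ hF hE
  refine ⟨t, hσt, ht0, fun ⟨w, _, hw⟩ => htn w hw.symm, fun q hσq hq0 => ?_⟩
  rcases hdich q hσq hq0 with ⟨s, hs⟩ | ⟨s, hs⟩
  · refine Or.inl ⟨s, ?_, hs.symm⟩
    rintro rfl
    rw [zero_mul] at hs
    exact hq0 hs.symm
  · refine Or.inr ⟨s, ?_, hs.symm⟩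
    rintro rfl
    rw [zero_mul] at hs
    exact (mul_ne_zero ht0 hq0) hs.symm

end Literature.NumberTheory.Rogawski1990.Ch3Sec10to13

end
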